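/-
Copyright (c) 2026 the pub-hodgecm-mathlib formalisation cell (harness21).  Prover seat hodgecm-mathlib-K2Liu-p06 (g3): Track B «K2-LIT»,
hLiu418 = stmt-HodgeConjecture-24832, director req649 (S1) ∕ LEAD F0P6-plan (g11) deal of record 2026-09-04T05:23:13Z = organ Φ2 of ROAD Φ
(ruling «M-155l» §2; CENSUS-41 row Φ2): file 2 «ORBIT VANISHING»; 2026-09-04.
-/
import Summits.HodgeConjecture.HodgeConjecture.Theorems.K2LiuSiegelEisensteinCoeffCells   -- ★ Φ2 file 1 (+ Φ1 (A1)(A2)(D), O41.4)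
import HarnessLib

/-!
# Crux `HLiu418`, ROAD Φ, organ Φ2 (file 2): THE ORBIT-VANISHING CRITERION — a middle `N_Δ(L⁺)`-orbit of `P_Δ(L⁺)\H(L⁺)` contributes NOTHING to the
# `S`-th Fourier coefficient as soon as its adelic stabiliser contains an `s₀` with `ψ_S(s₀) ≠ 1`

Cell `hodgecm-mathlib`, crux item hLiu418 = `stmt-HodgeConjecture-24832`, route `HCCMUnconditional`; squad K2 ∕ K2Liu, LEAD F0P6-plan (g11 → g12), deal req649
(S1) (memo `F0/P6/F0P6-plan-g11/DEALS-req649-S1S2S3.v1.F0P6-plan-g11.md` §(S1): «for `det β ≠ 0` … the middle-cell contributions VANISH (a non-trivial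
character integrates to 0 over a compact quotient)»), prover K2Liu-p06 (g3).  THEOREMS ONLY (no `def`, no instance, no notation, no named-fact hypothesis,
no `sorry`); lane `--supports stmt-HodgeConjecture-24832 --as helper` (count-neutral).

THE MECHANISM (covering-weight currency, ★ `Literature/MeasureTheory/Group/CoveringWeights{,Bochner}`).  After the twisted three cells of ★ file 1
(`fourierCoeff_three_cells`), the middle term is a sum of `J_S(q) = ∫ β(u) • (conj ψ_S(u) f(γ_q u h)) dνN(u)` over the cosets `q ∈ REST`; regrouped along
an `N_Δ(L⁺)`-orbit `{[γ₀ ν]}` with stabiliser `Γ' = Stab_{N_Δ(L⁺)}([γ₀])` (★ B2b `mk_mul_eq_mk_iff`) it becomes ONE integral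
`∫ β'(u) • (conj ψ_S(u) · f(γ₀ u h)) dνN(u)` against a `Γ'`-COVERING WEIGHT `β'` (★ `integral_wt_smul_eq_integral_wt_smul_tsum`; `Γ'\N_Δ(𝔸)` is NOT
compact, so `β'` has infinite mass and integrability must come from the binder (H), not from boundedness).  THIS FILE proves that such an integral
VANISHES as soon as the integrand's `f`-factor is invariant under ONE MORE translation `s₀ ∈ N_Δ(𝔸)` with `ψ_S(s₀) ≠ 1`:

* **`integral_wt_smul_conj_mul_eq_zero_of_invariant`** (V1, abstract): `Γ' ≤ N_Δ(𝔸)` a countable subgroup of RATIONAL unipotents, `β'` a `Γ'`-covering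
  weight, `g : N_Δ(𝔸) → ℂ` strongly measurable, `Γ'`-invariant and `s₀`-invariant (`g(s₀ u) = g(u)`), `∫⁻ ‖g‖ₑ β' dνN < ∞`, `ψ_S(s₀) ≠ 1` ⟹
  `∫ β'(u) • (conj ψ_S(u) · g(u)) dνN(u) = 0`.  Proof: translate by `s₀` (left-invariance of `νN`; `β'(s₀ ·)` is again a `Γ'`-covering weight because
  `N_Δ(𝔸)` is commutative) and use ★ weight independence: `I = ψ_S(s₀) · I`.  (★ Φ1 (A2) `integral_wt_smul_unipDeltaChar_eq_zero` is the case `g = 1`,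
  `Γ' = N_Δ(L⁺)`.)
* **`integral_wt_smul_conj_mul_apply_eq_zero`** (V1′, the Eisenstein instance): `g(u) = f(γ₀ u h)` for a Siegel section `f` of `I_Δ(s, χ)`, `γ₀ ∈ H(L⁺)`:
  the `Γ'`-invariance holds when `γ₀ Γ' γ₀⁻¹ ⊆ P_Δ(L⁺)` (★ #10b `apply_siegelDeltaRat_mul`), the `s₀`-invariance when `γ₀ s₀ γ₀⁻¹ ∈ P_Δ(𝔸)` with trivial
  inducing character `χ(det_Δ)|det_Δ|^{s+n/2} = 1` (e.g. `γ₀ s₀ γ₀⁻¹ ∈ N_Δ(𝔸)`, ★ D9 `siegelDeltaCharacter_eq_one_of_mem_unipDelta`); then the orbit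
  integral is `0`.
WHAT REMAINS for «`det S ≠ 0 ⇒ MID_S = 0`» (not in this file; census for the LEAD): (E1) the Bruhat EXHAUSTION `REST ⊆ {0 < rank C < n}` (organ O41.1 B2c)
with, for each such `γ₀`, an ADELIC stabiliser element `s₀ = n(X)`, `C X C' = 0`, on which `ψ_S` is non-trivial whenever `det S ≠ 0` (★ B2b
`isSiegelDelta_conj_unip_iff` gives the corner condition for the reflections `w_g`); (E2) the regrouping `Σ_{q ∈ orbit} J_S(q) = ∫ β' • (conj ψ_S · f(γ₀ · h))`
(★ `integral_wt_smul_eq_integral_wt_smul_tsum` with `Γ' ≤ Γ = N_Δ(L⁺)` and coset representatives, finiteness from (H)).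
[MoeglinWaldspurger1995, II.1.7], [KudlaRallis1994, §2 (2.10)–(2.12)], [Tan1999, §3], [Shimura1997, §18.3], [GelbartPiatetskishapiroRallis1987, Part A §2].

HONEST LABEL.  Count-neutral helper; `HC_CM` is proved only modulo the 7 printed citations (2 remaining named inputs: hLiu418 = `stmt-HodgeConjecture-24832`,
h413 = `stmt-HodgeConjecture-24833`) until rung 0 closes.
-/

set_option autoImplicit false
set_option linter.dupNamespace false -- the mandated namespace repeats `HodgeConjecture.HodgeConjecture`

noncomputable section

open scoped Matrix ENNReal NNReal ComplexConjugate
open NumberField IsDedekindDomain MeasureTheory MeasureTheory.Measure Filter Set Function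
open Literature.NumberTheory.Automorphic Literature.NumberTheory.GaloisRepresentations
open Literature.NumberTheory.GelbartRogawski1991 Literature.NumberTheory.GelbartRogawski1991.GRConstruction
open Literature.NumberTheory.K2Lit.SiegelDoubled Literature.MeasureTheory.Group

namespace Summit.HodgeConjecture.HodgeConjecture.Cruxes.HLiu418.K2LiuSiegelEisensteinCoeffOrbitVanishing

open K2LiuSiegelEisensteinDoubledLeftInvariant K2LiuUnipotentCoveringWeight K2LiuConstantTermDelta K2LiuSiegelUnipotentFourierDefs
  K2LiuSiegelUnipotentCharacters K2LiuSiegelFourierCoeffDelta K2LiuSiegelEisensteinCoeffCells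

variable {L : Type} [Field L] [NumberField L] [IsCMField L]
variable {N M n : ℕ} {e : Fin N × Fin M ≃ Fin n}
  {dV : Fin N → L} {hdV : ∀ i, IsCMField.complexConj L (dV i) = dV i}
  {dW : Fin M → L} {hdW : ∀ i, IsCMField.complexConj L (dW i) = dW i}
variable [MeasurableSpace (unipDelta L e dV hdV dW hdW)] [BorelSpace (unipDelta L e dV hdV dW hdW)]

/-! ## §1 Covering weights for a subgroup of rational unipotents -/

/-- a left translate of a `Γ'`-covering weight is again one, for ANY subgroup `Γ' ≤ N_Δ(𝔸)` (`N_Δ(𝔸)` is commutative, ★ D9 `mul_comm_of_mem_unipDelta`).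
[folklore] -/
theorem isCoveringWeight_subgroup_comp_mul_left (Γ' : Subgroup (unipDelta L e dV hdV dW hdW)) {β : unipDelta L e dV hdV dW hdW → ℝ≥0∞}
    (hβ : IsCoveringWeight Γ' β) (u₀ : unipDelta L e dV hdV dW hdW) : IsCoveringWeight Γ' fun u => β (u₀ * u) := by
  refine ⟨hβ.1.comp (measurable_const_mul u₀), fun u => ?_⟩
  have h := hβ.2 (u₀ * u)
  rw [coveringSum_apply] at h ⊢
  rw [← h]
  refine tsum_congr fun γ => ?_
  have hc : u₀ * (γ : unipDelta L e dV hdV dW hdW) = (γ : unipDelta L e dV hdV dW hdW) * u₀ :=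
    Subtype.ext (mul_comm_of_mem_unipDelta L e dV hdV dW hdW u₀.2 (γ : unipDelta L e dV hdV dW hdW).2)
  show β (u₀ * ((γ : unipDelta L e dV hdV dW hdW) * u)) = β ((γ : unipDelta L e dV hdV dW hdW) * (u₀ * u))
  rw [← mul_assoc, ← mul_assoc, hc]

omit [MeasurableSpace (unipDelta L e dV hdV dW hdW)] [BorelSpace (unipDelta L e dV hdV dW hdW)] in
/-- `ψ_S` is invariant under a subgroup of RATIONAL unipotents. [cite: MoeglinWaldspurger1995, I.2.6] -/
theorem unipDeltaChar_subgroup_smul (Γ' : Subgroup (unipDelta L e dV hdV dW hdW))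
    (hΓ' : ∀ γ ∈ Γ', ((γ : unipDelta L e dV hdV dW hdW) : HA L e dV hdV dW hdW) ∈ ratH L e dV hdV dW hdW) (S : Matrix (Fin n) (Fin n) L)
    (γ : Γ') (u : unipDelta L e dV hdV dW hdW) :
    unipDeltaChar L e dV hdV dW hdW S ((γ • u : unipDelta L e dV hdV dW hdW) : HA L e dV hdV dW hdW) = unipDeltaChar L e dV hdV dW hdW S (u : HA L e dV hdV dW hdW) := by
  rw [Subgroup.smul_def, smul_eq_mul, Subgroup.coe_mul, unipDeltaChar_mul L e dV hdV dW hdW S (γ : unipDelta L e dV hdV dW hdW).2 u.2,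
    unipDeltaChar_eq_one_of_mem_ratH L e dV hdV dW hdW S (hΓ' _ γ.2), one_mul]

/-! ## §2 The abstract orbit-vanishing criterion -/

/-- **ORBIT VANISHING (V1, abstract)**: `νN` left-invariant on `N_Δ(𝔸)`; `Γ' ≤ N_Δ(𝔸)` a countable subgroup of rational unipotents; `β'` a `Γ'`-covering
weight; `g : N_Δ(𝔸) → ℂ` strongly measurable, `Γ'`-invariant, with `∫⁻ ‖g‖ₑ β' dνN ≠ ∞`; `s₀ ∈ N_Δ(𝔸)` with `g(s₀ u) = g(u)` for all `u` and `ψ_S(s₀) ≠ 1`.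
THEN `∫ β'(u) • (conj ψ_S(u) · g(u)) dνN(u) = 0` — «a non-trivial character of the compact piece `Stab(L⁺)\Stab(𝔸)` of the orbit integrates to zero»,
by the translation `u ↦ s₀ u` and ★ weight independence. [cite: MoeglinWaldspurger1995, II.1.7] [cite: KudlaRallis1994, §2] [cite: Tan1999, §3] -/
theorem integral_wt_smul_conj_mul_eq_zero_of_invariant (νN : Measure (unipDelta L e dV hdV dW hdW)) [νN.IsMulLeftInvariant]
    (Γ' : Subgroup (unipDelta L e dV hdV dW hdW)) [Countable Γ']
    (hΓ' : ∀ γ ∈ Γ', ((γ : unipDelta L e dV hdV dW hdW) : HA L e dV hdV dW hdW) ∈ ratH L e dV hdV dW hdW)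
    {β' : unipDelta L e dV hdV dW hdW → ℝ≥0∞} (hβ' : IsCoveringWeight Γ' β') (S : Matrix (Fin n) (Fin n) L)
    {g : unipDelta L e dV hdV dW hdW → ℂ} (hgm : StronglyMeasurable g) (hgΓ : ∀ (γ : Γ') (u : unipDelta L e dV hdV dW hdW), g (γ • u) = g u)
    (hint : ∫⁻ u, ‖g u‖ₑ * β' u ∂νN ≠ ∞)
    {s₀ : unipDelta L e dV hdV dW hdW} (hgs : ∀ u, g (s₀ * u) = g u) (hs₀ : unipDeltaChar L e dV hdV dW hdW S (s₀ : HA L e dV hdV dW hdW) ≠ 1) :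
    ∫ u, (β' u).toReal • (conj (unipDeltaChar L e dV hdV dW hdW S (u : HA L e dV hdV dW hdW) : ℂ) * g u) ∂νN = 0 := by
  haveI : MeasurableConstSMul Γ' (unipDelta L e dV hdV dW hdW) := ⟨fun γ => measurable_const_mul (γ : unipDelta L e dV hdV dW hdW)⟩
  haveI : SMulInvariantMeasure Γ' (unipDelta L e dV hdV dW hdW) νN := ⟨fun γ t _ht => measure_preimage_mul νN (γ : unipDelta L e dV hdV dW hdW) t⟩
  -- the integrand `F = conj ψ_S · g` and its invariances
  set F : unipDelta L e dV hdV dW hdW → ℂ := fun u => conj (unipDeltaChar L e dV hdV dW hdW S (u : HA L e dV hdV dW hdW) : ℂ) * g u with hFdef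
  have hFm : StronglyMeasurable F := ((Complex.continuous_conj.comp (continuous_unipDeltaChar_coe L e dV hdV dW hdW S)).stronglyMeasurable).mul hgm
  have hFinv : ∀ (γ : Γ') (u : unipDelta L e dV hdV dW hdW), F (γ • u) = F u := fun γ u => by
    simp only [hFdef, unipDeltaChar_subgroup_smul Γ' hΓ' S γ u, hgΓ γ u]
  have hFn : ∀ u, ‖F u‖ₑ = ‖g u‖ₑ := fun u => by rw [hFdef]; dsimp only; rw [← ofReal_norm, norm_conj_unipDeltaChar_mul, ofReal_norm]
  have hint' : ∫⁻ u, ‖F u‖ₑ * β' u ∂νN < ∞ := by simp_rw [hFn]; exact lt_top_iff_ne_top.2 hint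
  -- the translated weight `β'(s₀ ·)`
  have hβ'' := isCoveringWeight_subgroup_comp_mul_left Γ' hβ' s₀
  -- (1) weight independence: `∫ β'(s₀ u) • F u = ∫ β'(u) • F u`
  have h1 : ∫ u, (β' (s₀ * u)).toReal • F u ∂νN = ∫ u, (β' u).toReal • F u ∂νN :=
    (integral_wt_smul_eq_of_coveringSum_eq_one νN hFm hFinv hβ'.1 hβ''.1 hβ'.2 hβ''.2 hint').symm
  -- (2) left-invariance: `∫ β'(s₀ u) • F u = ∫ β'(v) • F(s₀⁻¹ v) = ψ_S(s₀) ∫ β' • F`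
  have hFs : ∀ v, F (s₀⁻¹ * v) = (unipDeltaChar L e dV hdV dW hdW S (s₀ : HA L e dV hdV dW hdW) : ℂ) * F v := by
    intro v
    have hg' : g (s₀⁻¹ * v) = g v := by rw [← hgs (s₀⁻¹ * v), mul_inv_cancel_left]
    rw [hFdef]
    dsimp only
    rw [hg', Subgroup.coe_mul, unipDeltaChar_mul L e dV hdV dW hdW S (s₀⁻¹).2 v.2, Subgroup.coe_inv, unipDeltaChar_inv L e dV hdV dW hdW S s₀.2,
      Circle.coe_mul, map_mul, Circle.coe_inv_eq_conj, Complex.conj_conj, mul_assoc]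
  have h2 : ∫ u, (β' (s₀ * u)).toReal • F u ∂νN = (unipDeltaChar L e dV hdV dW hdW S (s₀ : HA L e dV hdV dW hdW) : ℂ) * ∫ u, (β' u).toReal • F u ∂νN := by
    have h3 : ∀ u : unipDelta L e dV hdV dW hdW, (β' (s₀ * u)).toReal • F u =
        (unipDeltaChar L e dV hdV dW hdW S (s₀ : HA L e dV hdV dW hdW) : ℂ) * ((β' (s₀ * u)).toReal • F (s₀ * u)) := fun u => by
      have hu : F u = (unipDeltaChar L e dV hdV dW hdW S (s₀ : HA L e dV hdV dW hdW) : ℂ) * F (s₀ * u) := by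
        rw [← hFs (s₀ * u), inv_mul_cancel_left]
      rw [hu, mul_smul_comm]
    simp_rw [h3]
    rw [integral_const_mul, integral_mul_left_eq_self (fun v : unipDelta L e dV hdV dW hdW => (β' v).toReal • F v) s₀]
  -- (3) conclude: `(ψ_S(s₀) − 1) · I = 0`
  have hne : (unipDeltaChar L e dV hdV dW hdW S (s₀ : HA L e dV hdV dW hdW) : ℂ) - 1 ≠ 0 := by
    rw [sub_ne_zero, ne_eq, ← Circle.coe_one, Circle.coe_inj]
    exact hs₀
  have h4 : ((unipDeltaChar L e dV hdV dW hdW S (s₀ : HA L e dV hdV dW hdW) : ℂ) - 1) * ∫ u, (β' u).toReal • F u ∂νN = 0 := by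
    rw [sub_mul, one_mul, ← h2, h1, sub_self]
  exact (mul_eq_zero.1 h4).resolve_left hne

/-! ## §3 The Eisenstein instance: `g(u) = f(γ₀ u h)` -/

/-- **ORBIT VANISHING (V1′, for a translate of a Siegel section)**: `f` a continuous Siegel section of `I_Δ(s, χ)`, `γ₀ ∈ H(L⁺)`, `h ∈ H(𝔸)`; `Γ' ≤ N_Δ(𝔸)`
countable, rational, with `γ₀ Γ' γ₀⁻¹ ⊆ P_Δ` (then `f(γ₀ γ u h) = f(γ₀ u h)`: the conjugate is a RATIONAL Siegel element, on which the inducing character is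
trivial, ★ #10b `apply_siegelDeltaRat_mul`); `β'` a `Γ'`-covering weight with `∫⁻ ‖f(γ₀ u h)‖ₑ β'(u) dνN ≠ ∞`; and an ADELIC stabiliser element
`s₀ ∈ N_Δ(𝔸)`: `γ₀ s₀ γ₀⁻¹ ∈ P_Δ(𝔸)` with `χ(det_Δ)|det_Δ|^{s+n/2}(γ₀ s₀ γ₀⁻¹) = 1` and `ψ_S(s₀) ≠ 1`.  THEN
`∫ β'(u) • (conj ψ_S(u) · f(γ₀ u h)) dνN(u) = 0`. [cite: MoeglinWaldspurger1995, II.1.7] [cite: KudlaRallis1994, §2] [cite: Tan1999, §3] -/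
theorem integral_wt_smul_conj_mul_apply_eq_zero (νN : Measure (unipDelta L e dV hdV dW hdW)) [νN.IsMulLeftInvariant]
    (Γ' : Subgroup (unipDelta L e dV hdV dW hdW)) [Countable Γ']
    (hΓ' : ∀ γ ∈ Γ', ((γ : unipDelta L e dV hdV dW hdW) : HA L e dV hdV dW hdW) ∈ ratH L e dV hdV dW hdW)
    {β' : unipDelta L e dV hdV dW hdW → ℝ≥0∞} (hβ' : IsCoveringWeight Γ' β') (S : Matrix (Fin n) (Fin n) L)
    {χ : HeckeCharacter L} {s : ℂ} {f : HA L e dV hdV dW hdW → ℂ} (hf : IsSiegelDeltaSection L e dV hdV dW hdW χ s f) (hfc : Continuous f)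
    (γ₀ : ratH L e dV hdV dW hdW) (h : HA L e dV hdV dW hdW)
    (hΓ'P : ∀ γ ∈ Γ', IsSiegelDelta L e dV hdV dW hdW
      ((γ₀ : HA L e dV hdV dW hdW) * ((γ : unipDelta L e dV hdV dW hdW) : HA L e dV hdV dW hdW) * ((γ₀ : HA L e dV hdV dW hdW))⁻¹))
    (hint : ∫⁻ u, ‖f ((γ₀ : HA L e dV hdV dW hdW) * (u : HA L e dV hdV dW hdW) * h)‖ₑ * β' u ∂νN ≠ ∞)
    {s₀ : unipDelta L e dV hdV dW hdW}
    (hs₀P : IsSiegelDelta L e dV hdV dW hdW ((γ₀ : HA L e dV hdV dW hdW) * (s₀ : HA L e dV hdV dW hdW) * ((γ₀ : HA L e dV hdV dW hdW))⁻¹))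
    (hs₀χ : siegelDeltaCharacter L e dV hdV dW hdW χ s ((γ₀ : HA L e dV hdV dW hdW) * (s₀ : HA L e dV hdV dW hdW) * ((γ₀ : HA L e dV hdV dW hdW))⁻¹) = 1)
    (hs₀ : unipDeltaChar L e dV hdV dW hdW S (s₀ : HA L e dV hdV dW hdW) ≠ 1) :
    ∫ u, (β' u).toReal • (conj (unipDeltaChar L e dV hdV dW hdW S (u : HA L e dV hdV dW hdW) : ℂ) *
      f ((γ₀ : HA L e dV hdV dW hdW) * (u : HA L e dV hdV dW hdW) * h)) ∂νN = 0 := by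
  -- conjugation identity `γ₀ x u h = (γ₀ x γ₀⁻¹) (γ₀ u h)`
  have hconj : ∀ (x : HA L e dV hdV dW hdW) (u : unipDelta L e dV hdV dW hdW),
      (γ₀ : HA L e dV hdV dW hdW) * (x * (u : HA L e dV hdV dW hdW)) * h =
        ((γ₀ : HA L e dV hdV dW hdW) * x * ((γ₀ : HA L e dV hdV dW hdW))⁻¹) * ((γ₀ : HA L e dV hdV dW hdW) * (u : HA L e dV hdV dW hdW) * h) := fun x u => by
    simp only [mul_assoc, inv_mul_cancel_left]
  refine integral_wt_smul_conj_mul_eq_zero_of_invariant νN Γ' hΓ' hβ' S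
    (g := fun u : unipDelta L e dV hdV dW hdW => f ((γ₀ : HA L e dV hdV dW hdW) * (u : HA L e dV hdV dW hdW) * h))
    ((hfc.comp ((continuous_const.mul continuous_subtype_val).mul continuous_const)).stronglyMeasurable) (fun γ u => ?_) hint (fun u => ?_) hs₀
  · -- `Γ'`-invariance: `γ₀ γ γ₀⁻¹` is a RATIONAL Siegel element
    have hrat : (γ₀ : HA L e dV hdV dW hdW) * ((γ : unipDelta L e dV hdV dW hdW) : HA L e dV hdV dW hdW) * ((γ₀ : HA L e dV hdV dW hdW))⁻¹ ∈
        ratH L e dV hdV dW hdW := mul_mem (mul_mem γ₀.2 (hΓ' _ γ.2)) (inv_mem γ₀.2)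
    set p : siegelDeltaRat L e dV hdV dW hdW := ⟨⟨_, hrat⟩, Subgroup.mem_subgroupOf.2
      ((mem_siegelDelta_iff L e dV hdV dW hdW _).2 (hΓ'P _ γ.2))⟩ with hp
    show f ((γ₀ : HA L e dV hdV dW hdW) * (((γ • u : unipDelta L e dV hdV dW hdW)) : HA L e dV hdV dW hdW) * h) = f ((γ₀ : HA L e dV hdV dW hdW) * (u : HA L e dV hdV dW hdW) * h)
    rw [Subgroup.smul_def, smul_eq_mul, Subgroup.coe_mul, hconj]
    exact apply_siegelDeltaRat_mul L e dV hdV dW hdW hf p _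
  · -- `s₀`-invariance: `γ₀ s₀ γ₀⁻¹ ∈ P_Δ(𝔸)` with trivial inducing character
    show f ((γ₀ : HA L e dV hdV dW hdW) * (((s₀ * u : unipDelta L e dV hdV dW hdW)) : HA L e dV hdV dW hdW) * h) = f ((γ₀ : HA L e dV hdV dW hdW) * (u : HA L e dV hdV dW hdW) * h)
    rw [Subgroup.coe_mul, hconj, hf _ hs₀P, hs₀χ, one_mul]

/-- **… in particular when `γ₀ s₀ γ₀⁻¹ ∈ N_Δ(𝔸)`** (the inducing character is trivial on `N_Δ(𝔸)`, ★ D9 `siegelDeltaCharacter_eq_one_of_mem_unipDelta`) — the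
shape of the middle-cell stabilisers `w_g n(X) w_g` with the corner condition `(1 − G) X (1 − G) = 0` of ★ B2b. [cite: MoeglinWaldspurger1995, II.1.7]
[cite: KudlaRallis1994, §2] -/
theorem integral_wt_smul_conj_mul_apply_eq_zero_of_mem_unipDelta (νN : Measure (unipDelta L e dV hdV dW hdW)) [νN.IsMulLeftInvariant]
    (Γ' : Subgroup (unipDelta L e dV hdV dW hdW)) [Countable Γ']
    (hΓ' : ∀ γ ∈ Γ', ((γ : unipDelta L e dV hdV dW hdW) : HA L e dV hdV dW hdW) ∈ ratH L e dV hdV dW hdW)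
    {β' : unipDelta L e dV hdV dW hdW → ℝ≥0∞} (hβ' : IsCoveringWeight Γ' β') (S : Matrix (Fin n) (Fin n) L)
    {χ : HeckeCharacter L} {s : ℂ} {f : HA L e dV hdV dW hdW → ℂ} (hf : IsSiegelDeltaSection L e dV hdV dW hdW χ s f) (hfc : Continuous f)
    (γ₀ : ratH L e dV hdV dW hdW) (h : HA L e dV hdV dW hdW)
    (hΓ'P : ∀ γ ∈ Γ', IsSiegelDelta L e dV hdV dW hdW
      ((γ₀ : HA L e dV hdV dW hdW) * ((γ : unipDelta L e dV hdV dW hdW) : HA L e dV hdV dW hdW) * ((γ₀ : HA L e dV hdV dW hdW))⁻¹))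
    (hint : ∫⁻ u, ‖f ((γ₀ : HA L e dV hdV dW hdW) * (u : HA L e dV hdV dW hdW) * h)‖ₑ * β' u ∂νN ≠ ∞)
    {s₀ : unipDelta L e dV hdV dW hdW}
    (hs₀N : (γ₀ : HA L e dV hdV dW hdW) * (s₀ : HA L e dV hdV dW hdW) * ((γ₀ : HA L e dV hdV dW hdW))⁻¹ ∈ unipDelta L e dV hdV dW hdW)
    (hs₀ : unipDeltaChar L e dV hdV dW hdW S (s₀ : HA L e dV hdV dW hdW) ≠ 1) :
    ∫ u, (β' u).toReal • (conj (unipDeltaChar L e dV hdV dW hdW S (u : HA L e dV hdV dW hdW) : ℂ) *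
      f ((γ₀ : HA L e dV hdV dW hdW) * (u : HA L e dV hdV dW hdW) * h)) ∂νN = 0 :=
  integral_wt_smul_conj_mul_apply_eq_zero νN Γ' hΓ' hβ' S hf hfc γ₀ h hΓ'P hint (isSiegelDelta_of_mem_unipDelta L e dV hdV dW hdW hs₀N)
    (siegelDeltaCharacter_eq_one_of_mem_unipDelta L e dV hdV dW hdW χ s hs₀N) hs₀

end Summit.HodgeConjecture.HodgeConjecture.Cruxes.HLiu418.K2LiuSiegelEisensteinCoeffOrbitVanishing

end
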